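import Literature.NumberTheory.GaloisRepresentations.BrauerHassePrinciple
import Literature.NumberTheory.GaloisRepresentations.PadicIntCdOne
import Literature.NumberTheory.GaloisRepresentations.BrauerCocycleSubgroupTransfer
import Literature.NumberTheory.GaloisRepresentations.LocalMuCocycleSubgroupSplitting
import Literature.NumberTheory.GaloisRepresentations.CyclotomicTowerLocalIndex
import Literature.NumberTheory.GaloisRepresentations.TateLevelOneFiniteSupport
import Literature.NumberTheory.GaloisRepresentations.TateLevelOneHasseBridge
import Literature.NumberTheory.GaloisRepresentations.MuCocycleKummerSplitting
import Literature.NumberTheory.Automorphic.AdicCompletionLocalField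
import HarnessLib

/-!
# `p`-torsion Brauer classes of a number field die in a `ℤ_p`-tower with non-trivial local towers
# (Serre, *Cohomologie galoisienne* II §4.4 Prop. 13 with Lemme 1; II §3.3 Prop. 9)

Topic `NumberTheory/GaloisRepresentations`; namespace `Literature.NumberTheory.GaloisRepresentations`.
Theorems only (no definition, no named fact; D-0026).

Serre proves `cd_p(G_k) ≤ 2` for a number field `k` (`p ≠ 2`, or `k` totally imaginary) by showing
`cd_p(Gal(k̄/k_∞)) ≤ 1` for the cyclotomic `ℤ_p`-extension `k_∞ = ⋃ k_m` (Lemme 1: all finite local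
degrees of `k_∞/k` are `p^∞`), via II §3.3 Prop. 9: a class of `Br(k)[p] = H²(Γ_k, μ_p)` has finitely
many non-zero local components, each of which is killed by a local extension of degree divisible by `p`
(*Corps locaux* XIII §3), hence by `k_m` for `m` large; the Hasse principle
(Albert–Brauer–Hasse–Noether) then kills the class over `k_m`.  This file proves that statement in the
cochain language of the tree's Tate files (trivial module `ℤ/p ≅ μ_p ⊂ k`):

* `exists_nsmul_split_comap_span_pow_of_forall_ne_one` — **main theorem**.  Let `K` be a number field
  containing a primitive `p`-th root of unity, with `p ≠ 2` or `K` totally complex, and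
  `φ : Γ_K → ℤ_p` a continuous homomorphism which is non-trivial on every decomposition group
  (`φ ∘ res_v ≠ 1` for all finite `v`; e.g. the cyclotomic `ℤ_p`-extension,
  `exists_apply_resGal_ne_one_of_isCyclotomic'`).  Then every locally constant `p`-torsion
  `2`-cocycle `z : Γ_K × Γ_K → ℚ/ℤ` becomes, on the open subgroup `V_m = φ⁻¹(p^m ℤ_p)` for some `m`,
  the coboundary of a locally constant `p`-torsion cochain: `z = ∂β` on `V_m`.

Proof (assembled from the tree): `e = ζ^{pz}` is a `μ_p`-valued `K̄ˣ`-cocycle; its local components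
split with `p`-torsion cochains at almost all `v` (`twoCocycle_nsmul_split_levelOne_eventually`); at the
finitely many other `v` it splits on `res_v⁻¹(V_m)` once `p ∣ (Γ_{K_v} : res_v⁻¹(V_m))`
(`exists_cob_on_subgroup_of_pow_eq_one_of_dvd_index`, *Corps locaux* XIII §3 Prop. 7), which holds for
`m` large (`exists_dvd_index_comap_resGal_of_ne_one`); over the fixed field `K_m` of `V_m` the base
change of `e` is then locally trivial at the finite places (`exists_cob_adicCompletion_baseChange_of_subgroup`)
and at the infinite ones (`localSplitting_infinite_of_odd`, resp. `Γ_{ℂ} = 1`), hence a coboundary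
(`twoCocycle_cob_of_locallyTrivial`, ABHN); Hilbert 90 makes the cochain `μ_p`-valued (Kummer), and the
result is transported back to `V_m = res(Γ_{K_m})`.

## References

* J.-P. Serre, *Cohomologie galoisienne* / *Galois Cohomology* (1997), II §4.4 Prop. 13 and Lemme 1,
  II §3.3 Prop. 9. [SerreGaloisCohomology1997]
* J.-P. Serre, *Corps locaux* (1968), XIII §3 Prop. 7. [SerreLocalFields1979]
* J. W. S. Cassels, A. Fröhlich (eds.), *Algebraic Number Theory* (1967), Ch. VII §9.6–§10
  (Brauer–Hasse–Noether). [CasselsFrohlichANT1967]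
-/

noncomputable section

open Field ValuativeRel IsDedekindDomain NumberField IntermediateField
open scoped Pointwise NumberField

universe u

namespace Literature.NumberTheory.GaloisRepresentations

open LocalWeilDatum

section Main

variable (K : Type) [Field K] [NumberField K] {p : ℕ} [hp : Fact p.Prime]

/-- **`p`-torsion classes of `H²(Γ_K, ℤ/p) = Br(K)[p]` die in a `ℤ_p`-tower whose local towers are all
non-trivial** (Serre, *Cohomologie galoisienne* II §4.4 Prop. 13 with Lemme 1, and II §3.3 Prop. 9;
*Corps locaux* XIII §3 Prop. 7; Albert–Brauer–Hasse–Noether).  Let `K` be a number field containing a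
primitive `p`-th root of unity `ζ`, with `p ≠ 2` or `K` totally complex; let `φ : Γ_K → ℤ_p` be
continuous with `φ ∘ res_v` non-trivial for every finite place `v`; and let `z : Γ_K × Γ_K → ℚ/ℤ` be a
locally constant `2`-cocycle with `p • z = 0`.  Then for some `m` there is a locally constant
`β : V_m → ℚ/ℤ` on `V_m = φ⁻¹(p^m ℤ_p)` with `p • β = 0` and `z(x,y) + β(xy) = β(x) + β(y)` for all
`x, y ∈ V_m`. [cite: SerreGaloisCohomology1997, II §4.4 Prop. 13 (with Lemme 1) and II §3.3 Prop. 9]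
[cite: SerreLocalFields1979, XIII §3 Prop. 7] [cite: CasselsFrohlichANT1967, Ch. VII §9.6–§10] -/
theorem exists_nsmul_split_comap_span_pow_of_forall_ne_one
    {ζ : K} (hζ : IsPrimitiveRoot ζ p) (hKinf : p ≠ 2 ∨ ∀ w : InfinitePlace K, w.IsComplex)
    (φ : absoluteGaloisGroup K →ₜ* Multiplicative ℤ_[p])
    (hφ : ∀ v : HeightOneSpectrum (𝓞 K), ∃ σ : absoluteGaloisGroup (v.adicCompletion K),
      φ (absGaloisRestrict K (v.adicCompletion K) σ) ≠ 1)
    (z : absoluteGaloisGroup K → absoluteGaloisGroup K → AddCircle (1 : ℚ))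
    (hz_lc : IsLocallyConstant (Function.uncurry z))
    (hz_coc : ∀ σ τ υ, z σ τ + z (σ * τ) υ = z τ υ + z σ (τ * υ)) (hz_p : ∀ σ τ, p • z σ τ = 0) :
    ∃ (m : ℕ) (β : ((AddSubgroup.toSubgroup (Ideal.span {(p : ℤ_[p]) ^ m}).toAddSubgroup).comap φ.toMonoidHom) →
        AddCircle (1 : ℚ)),
      IsLocallyConstant β ∧ (∀ x, p • β x = 0) ∧
        ∀ x y : (AddSubgroup.toSubgroup (Ideal.span {(p : ℤ_[p]) ^ m}).toAddSubgroup).comap φ.toMonoidHom,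
          z x y + β (x * y) = β x + β y := by
  classical
  have hpp : p.Prime := hp.out
  haveI : NeZero p := ⟨hpp.ne_zero⟩
  haveI : CompactSpace (absoluteGaloisGroup K) := absoluteGaloisGroup_compactSpace K
  -- `ζ ∈ K̄` and the exponential `m : ℚ/ℤ → K̄`
  set ζb : AlgebraicClosure K := algebraMap K _ ζ with hζb_def
  have hζb : IsPrimitiveRoot ζb p := hζ.map_of_injective (algebraMap K _).injective
  have hζb0 : ζb ≠ 0 := hζb.ne_zero hpp.ne_zero
  have hζb_fix : ∀ σ : absoluteGaloisGroup K, σ • ζb = ζb := fun σ => by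
    rw [absoluteGaloisGroup.smul_def, hζb_def, AlgEquiv.commutes]
  obtain ⟨mexp, hm_add, hm_inj, hm0, hm_pow, hm_range, hm_surj⟩ :=
    exists_mulExp_of_isPrimitiveRoot hpp.pos hζb
  have hm0' : ∀ x, mexp x ≠ 0 := fun x => by
    obtain ⟨k, hk⟩ := hm_range x
    rw [hk]
    exact pow_ne_zero _ hζb0
  have hm_fix : ∀ (ρ : absoluteGaloisGroup K) x, ρ • mexp x = mexp x := fun ρ x => by
    obtain ⟨k, hk⟩ := hm_range x
    rw [hk, smul_pow', hζb_fix]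
  have hm_sub : ∀ x y, p • x = 0 → p • y = 0 → mexp (x - y) * mexp y = mexp x := fun x y hx hy => by
    rw [← hm_add _ _ (by rw [nsmul_sub, hx, hy, sub_zero]) hy, sub_add_cancel]
  -- the units-valued cocycle `e = ζ^{pz}`
  set e : absoluteGaloisGroup K → absoluteGaloisGroup K → (AlgebraicClosure K)ˣ :=
    fun σ τ => Units.mk0 (mexp (z σ τ)) (hm0' _) with he_def
  have he_val : ∀ σ τ, (e σ τ : AlgebraicClosure K) = mexp (z σ τ) := fun _ _ => rfl
  have he_lc : IsLocallyConstant fun q : absoluteGaloisGroup K × absoluteGaloisGroup K => e q.1 q.2 :=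
    hz_lc.comp fun t => Units.mk0 (mexp t) (hm0' t)
  have he_coc : ∀ σ τ υ, e σ τ * e (σ * τ) υ = σ • e τ υ * e σ (τ * υ) := fun σ τ υ => by
    ext
    rw [Units.val_mul, Units.val_mul, Units.coe_smul, he_val, he_val, he_val, he_val, hm_fix,
      ← hm_add _ _ (hz_p _ _) (hz_p _ _), ← hm_add _ _ (hz_p _ _) (hz_p _ _), hz_coc]
  have he_pow : ∀ σ τ, e σ τ ^ p = 1 := fun σ τ => Units.ext (by rw [Units.val_pow_eq_pow_val, he_val, hm_pow, Units.val_one])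
  -- notation for the layers and their local traces
  set V : ℕ → Subgroup (absoluteGaloisGroup K) := fun m =>
    (AddSubgroup.toSubgroup (Ideal.span {(p : ℤ_[p]) ^ m}).toAddSubgroup).comap φ.toMonoidHom with hV
  have hVn : ∀ m, (V m).Normal := fun m => by rw [hV]; exact Subgroup.Normal.comap inferInstance _
  have hVo : ∀ m, IsOpen ((V m : Subgroup (absoluteGaloisGroup K)) : Set (absoluteGaloisGroup K)) :=
    fun m => isOpen_comap_span_pow φ m
  have hVanti : Antitone V := fun m m' hmm' σ hσ => by
    change σ ∈ (AddSubgroup.toSubgroup (Ideal.span {(p : ℤ_[p]) ^ m}).toAddSubgroup).comap φ.toMonoidHom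
    rw [mem_comap_span_pow_iff] at hσ ⊢
    exact (pow_dvd_pow _ hmm').trans hσ
  -- the local statement at a finite place `v` for the layer `m`
  let P : HeightOneSpectrum (𝓞 K) → ℕ → Prop := fun v m =>
    ∃ b : ((V m).comap ((absGaloisRestrict K (v.adicCompletion K) :
          absoluteGaloisGroup (v.adicCompletion K) →ₜ* absoluteGaloisGroup K) :
          absoluteGaloisGroup (v.adicCompletion K) →* absoluteGaloisGroup K)) →
        (AlgebraicClosure (v.adicCompletion K))ˣ,
      IsLocallyConstant b ∧ ∀ x y : (V m).comap ((absGaloisRestrict K (v.adicCompletion K) :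
          absoluteGaloisGroup (v.adicCompletion K) →ₜ* absoluteGaloisGroup K) :
          absoluteGaloisGroup (v.adicCompletion K) →* absoluteGaloisGroup K),
        Units.map (absClosureEmbedding K (v.adicCompletion K) :
            AlgebraicClosure K →* AlgebraicClosure (v.adicCompletion K))
          (e (absGaloisRestrict K (v.adicCompletion K) (x : absoluteGaloisGroup (v.adicCompletion K)))
            (absGaloisRestrict K (v.adicCompletion K) (y : absoluteGaloisGroup (v.adicCompletion K)))) =
        b x * (x : absoluteGaloisGroup (v.adicCompletion K)) • b y / b (x * y)
  -- the local cocycle at `v`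
  have hloc_cocycle : ∀ v : HeightOneSpectrum (𝓞 K),
      IsLocallyConstant (fun q : absoluteGaloisGroup (v.adicCompletion K) × absoluteGaloisGroup (v.adicCompletion K) =>
        Units.map (absClosureEmbedding K (v.adicCompletion K) :
            AlgebraicClosure K →* AlgebraicClosure (v.adicCompletion K))
          (e (absGaloisRestrict K (v.adicCompletion K) q.1) (absGaloisRestrict K (v.adicCompletion K) q.2))) ∧
      (∀ σ τ υ : absoluteGaloisGroup (v.adicCompletion K),
        Units.map (absClosureEmbedding K (v.adicCompletion K) :
            AlgebraicClosure K →* AlgebraicClosure (v.adicCompletion K))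
          (e (absGaloisRestrict K (v.adicCompletion K) σ) (absGaloisRestrict K (v.adicCompletion K) τ)) *
        Units.map (absClosureEmbedding K (v.adicCompletion K) :
            AlgebraicClosure K →* AlgebraicClosure (v.adicCompletion K))
          (e (absGaloisRestrict K (v.adicCompletion K) (σ * τ)) (absGaloisRestrict K (v.adicCompletion K) υ)) =
        σ • Units.map (absClosureEmbedding K (v.adicCompletion K) :
            AlgebraicClosure K →* AlgebraicClosure (v.adicCompletion K))
          (e (absGaloisRestrict K (v.adicCompletion K) τ) (absGaloisRestrict K (v.adicCompletion K) υ)) *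
        Units.map (absClosureEmbedding K (v.adicCompletion K) :
            AlgebraicClosure K →* AlgebraicClosure (v.adicCompletion K))
          (e (absGaloisRestrict K (v.adicCompletion K) σ) (absGaloisRestrict K (v.adicCompletion K) (τ * υ)))) ∧
      (∀ σ τ : absoluteGaloisGroup (v.adicCompletion K),
        Units.map (absClosureEmbedding K (v.adicCompletion K) :
            AlgebraicClosure K →* AlgebraicClosure (v.adicCompletion K))
          (e (absGaloisRestrict K (v.adicCompletion K) σ) (absGaloisRestrict K (v.adicCompletion K) τ)) ^ p = 1) := by
    intro v
    obtain ⟨hlc', hcoc'⟩ := twoCocycle_baseChange K (v.adicCompletion K) e he_lc he_coc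
    exact ⟨hlc', hcoc', fun σ τ => by rw [← map_pow, he_pow, map_one]⟩
  -- every finite place admits a layer beyond which the local statement holds
  have hP : ∀ v : HeightOneSpectrum (𝓞 K), ∃ m₀ : ℕ, ∀ m, m₀ ≤ m → P v m := by
    intro v
    haveI : CharZero (v.adicCompletion K) := LocalField.charZero_adicCompletion v
    obtain ⟨m₀, hm₀⟩ := exists_dvd_index_comap_resGal_of_ne_one K p φ v (hφ v)
    refine ⟨m₀, fun m hm => ?_⟩
    obtain ⟨hlc', hcoc', hpow'⟩ := hloc_cocycle v
    have hopen : IsOpen (((V m).comap ((absGaloisRestrict K (v.adicCompletion K) :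
          absoluteGaloisGroup (v.adicCompletion K) →ₜ* absoluteGaloisGroup K) :
          absoluteGaloisGroup (v.adicCompletion K) →* absoluteGaloisGroup K) :
        Subgroup (absoluteGaloisGroup (v.adicCompletion K))) : Set (absoluteGaloisGroup (v.adicCompletion K))) :=
      (hVo m).preimage (absGaloisRestrict K (v.adicCompletion K)).continuous
    exact exists_cob_on_subgroup_of_pow_eq_one_of_dvd_index (v.adicCompletion K) (p := p) _ hlc' hcoc' hpow' _
      hopen (hm₀ m hm)
  -- at almost all places the layer `0` already works
  have hgood : ∀ᶠ v : HeightOneSpectrum (𝓞 K) in Filter.cofinite, ∀ m, P v m := by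
    filter_upwards [twoCocycle_nsmul_split_levelOne_eventually K hpp.pos z hz_lc hz_coc hz_p] with v hv
    intro m
    obtain ⟨βv, hβv_lc, hβv, hβvp⟩ := hv
    let ι := absClosureEmbedding K (v.adicCompletion K)
    let r := absGaloisRestrict K (v.adicCompletion K)
    have hι_fix : ∀ (x : absoluteGaloisGroup (v.adicCompletion K)) t, x • ι (mexp t) = ι (mexp t) := fun x t => by
      obtain ⟨k, hk⟩ := hm_range t
      have hιζ : ι ζb = algebraMap (v.adicCompletion K) (AlgebraicClosure (v.adicCompletion K))
          (algebraMap K (v.adicCompletion K) ζ) := by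
        change absClosureEmbedding K (v.adicCompletion K) ζb = _
        rw [hζb_def, AlgHom.commutes,
          IsScalarTower.algebraMap_apply K (v.adicCompletion K) (AlgebraicClosure (v.adicCompletion K))]
      rw [hk, map_pow, smul_pow', hιζ, absoluteGaloisGroup.smul_def, AlgEquiv.commutes]
    have hι0 : ∀ t, ι (mexp t) ≠ 0 := fun t => (map_ne_zero ι).mpr (hm0' t)
    refine ⟨fun x => Units.mk0 (ι (mexp (βv x))) (hι0 _),
      (hβv_lc.comp_continuous continuous_subtype_val).comp fun t => Units.mk0 (ι (mexp t)) (hι0 t),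
      fun x y => ?_⟩
    ext
    rw [Units.val_div_eq_div_val, Units.val_mul, Units.coe_smul, Units.val_mk0, Units.val_mk0, Units.val_mk0,
      hι_fix, Subgroup.coe_mul]
    change ι ((e (r x) (r y) : AlgebraicClosure K)) = ι (mexp (βv x)) * ι (mexp (βv y)) / ι (mexp (βv (x * y)))
    have hzr : z (r x) (r y) = βv x + βv y - βv (x * y) := eq_sub_of_add_eq (hβv x y)
    rw [he_val, hzr, eq_div_iff (hι0 _), ← map_mul, ← map_mul,
      hm_sub _ _ (by rw [nsmul_add, hβvp, hβvp, add_zero]) (hβvp _), hm_add _ _ (hβvp _) (hβvp _)]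
  -- a layer `m` that works at every finite place
  obtain ⟨m, hmP⟩ : ∃ m : ℕ, ∀ v, P v m := by
    have hSfin : {v : HeightOneSpectrum (𝓞 K) | ¬ ∀ m, P v m}.Finite := Filter.eventually_cofinite.1 hgood
    choose m₀ hm₀ using hP
    refine ⟨hSfin.toFinset.sup m₀, fun v => ?_⟩
    by_cases hvS : v ∈ {v : HeightOneSpectrum (𝓞 K) | ¬ ∀ m, P v m}
    · exact hm₀ v _ (Finset.le_sup (hSfin.mem_toFinset.2 hvS))
    · rw [Set.mem_setOf_eq, not_not] at hvS
      exact hvS _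
  haveI : (V m).Normal := hVn m
  -- the fixed field `K_m` of `V_m`, a number field
  obtain ⟨Km, hKmfin, hKm⟩ := exists_galFixing_eq_of_isOpen (V m) (hVo m)
  haveI : FiniteDimensional K Km := hKmfin
  haveI : CharZero Km := charZero_of_injective_algebraMap (algebraMap K Km).injective
  haveI : NumberField Km :=
    { to_charZero := inferInstance
      to_finiteDimensional := Module.Finite.trans K Km }
  haveI : Algebra.IsAlgebraic K Km := Algebra.IsAlgebraic.of_finite K Km
  -- `res(Γ_{K_m}) = V_m`
  obtain ⟨τ, hτ⟩ := exists_range_absGaloisRestrict_eq_map_conj K Km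
  have hVconj : (V m).map (MulAut.conj τ).toMonoidHom = V m := by
    ext x
    constructor
    · rintro ⟨y, hy, rfl⟩
      exact (hVn m).conj_mem y hy τ
    · intro hx
      refine ⟨τ⁻¹ * x * τ, ?_, ?_⟩
      · have := (hVn m).conj_mem x hx τ⁻¹
        rwa [inv_inv] at this
      · change τ * (τ⁻¹ * x * τ) * τ⁻¹ = x
        group
  have hrange : ((absGaloisRestrict K Km : absoluteGaloisGroup Km →ₜ* absoluteGaloisGroup K) :
      absoluteGaloisGroup Km →* absoluteGaloisGroup K).range = V m := by
    rw [hτ, hKm, hVconj]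
  have hVres : ∀ σ : absoluteGaloisGroup Km, absGaloisRestrict K Km σ ∈ V m := fun σ => by
    rw [← hrange]
    exact ⟨σ, rfl⟩
  -- the base change `e'` of `e` to `Γ_{K_m}` is locally trivial everywhere
  obtain ⟨he'_lc, he'_coc⟩ := twoCocycle_baseChange K Km e he_lc he_coc
  have hfin' := fun w' : HeightOneSpectrum (𝓞 Km) =>
    exists_cob_adicCompletion_baseChange_of_subgroup e he_lc he_coc (V m) hVres w' (hmP (w'.under (𝓞 K)))
  have hinf' : ∀ w : InfinitePlace Km,
      ∃ b : absoluteGaloisGroup w.Completion → (AlgebraicClosure w.Completion)ˣ,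
        IsLocallyConstant b ∧ ∀ x y,
          Units.map (absClosureEmbedding Km w.Completion : AlgebraicClosure Km →* AlgebraicClosure w.Completion)
            (Units.map (absClosureEmbedding K Km : AlgebraicClosure K →* AlgebraicClosure Km)
              (e (absGaloisRestrict K Km (absGaloisRestrict Km w.Completion x))
                (absGaloisRestrict K Km (absGaloisRestrict Km w.Completion y)))) =
          b x * x • b y / b (x * y) := by
    intro w
    let ι : AlgebraicClosure K →+* AlgebraicClosure w.Completion :=
      (absClosureEmbedding Km w.Completion : AlgebraicClosure Km →+* AlgebraicClosure w.Completion).comp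
        (absClosureEmbedding K Km : AlgebraicClosure K →+* AlgebraicClosure Km)
    let r : absoluteGaloisGroup w.Completion →* absoluteGaloisGroup K :=
      ((absGaloisRestrict K Km : absoluteGaloisGroup Km →ₜ* absoluteGaloisGroup K) :
        absoluteGaloisGroup Km →* absoluteGaloisGroup K).comp
        ((absGaloisRestrict Km w.Completion : absoluteGaloisGroup w.Completion →ₜ* absoluteGaloisGroup Km) :
          absoluteGaloisGroup w.Completion →* absoluteGaloisGroup Km)
    have hrcont : Continuous r := (absGaloisRestrict K Km).continuous.comp (absGaloisRestrict Km w.Completion).continuous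
    have hι_fix : ∀ (x : absoluteGaloisGroup w.Completion) t, x • ι (mexp t) = ι (mexp t) := fun x t => by
      obtain ⟨k, hk⟩ := hm_range t
      have hιζ : ι ζb = algebraMap w.Completion (AlgebraicClosure w.Completion)
          (algebraMap Km w.Completion (algebraMap K Km ζ)) := by
        change absClosureEmbedding Km w.Completion (absClosureEmbedding K Km ζb) = _
        rw [hζb_def, AlgHom.commutes, IsScalarTower.algebraMap_apply K Km (AlgebraicClosure Km), AlgHom.commutes,
          IsScalarTower.algebraMap_apply Km w.Completion (AlgebraicClosure w.Completion)]
      rw [hk, map_pow, smul_pow', hιζ, absoluteGaloisGroup.smul_def, AlgEquiv.commutes]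
    have hι0 : ∀ t, ι (mexp t) ≠ 0 := fun t => (map_ne_zero ι).mpr (hm0' t)
    -- a `p`-torsion splitting of `z ∘ (r × r)` on `Γ_{(K_m)_w}`
    obtain ⟨βw, hβw_lc, hβw, hβwp⟩ : ∃ βw : absoluteGaloisGroup w.Completion → AddCircle (1 : ℚ),
        IsLocallyConstant βw ∧ (∀ x y, z (r x) (r y) + βw (x * y) = βw x + βw y) ∧ ∀ x, p • βw x = 0 := by
      rcases hKinf with hp2 | hcx
      · exact localSplitting_infinite_of_odd w hpp hp2 (fun x y => z (r x) (r y))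
          (hz_lc.comp_continuous (hrcont.prodMap hrcont))
          (fun x y u => by simpa only [map_mul] using hz_coc (r x) (r y) (r u)) (fun x y => hz_p _ _)
      · have hcxw : w.IsComplex :=
          InfinitePlace.IsComplex.of_comap (algebraMap K Km) (hcx (w.comap (algebraMap K Km)))
        haveI := subsingleton_absoluteGaloisGroup_completion_of_isComplex w hcxw
        refine ⟨fun _ => z 1 1, IsLocallyConstant.const _, fun x y => ?_, fun x => hz_p _ _⟩
        rw [Subsingleton.elim x 1, Subsingleton.elim y 1, mul_one, map_one]
    refine ⟨fun x => Units.mk0 (ι (mexp (βw x))) (hι0 _), hβw_lc.comp fun t => Units.mk0 (ι (mexp t)) (hι0 t),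
      fun x y => ?_⟩
    ext
    rw [Units.val_div_eq_div_val, Units.val_mul, Units.coe_smul, Units.val_mk0, Units.val_mk0, Units.val_mk0,
      hι_fix]
    change ι ((e (r x) (r y) : AlgebraicClosure K)) = ι (mexp (βw x)) * ι (mexp (βw y)) / ι (mexp (βw (x * y)))
    have hzr : z (r x) (r y) = βw x + βw y - βw (x * y) := eq_sub_of_add_eq (hβw x y)
    rw [he_val, hzr, eq_div_iff (hι0 _), ← map_mul, ← map_mul,
      hm_sub _ _ (by rw [nsmul_add, hβwp, hβwp, add_zero]) (hβwp _), hm_add _ _ (hβwp _) (hβwp _)]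
  -- ABHN over `K_m`: `e' = ∂b'`
  obtain ⟨b', hb'_lc, hb'⟩ := twoCocycle_cob_of_locallyTrivial (K := Km)
    (fun x y => Units.map (absClosureEmbedding K Km : AlgebraicClosure K →* AlgebraicClosure Km)
      (e (absGaloisRestrict K Km x) (absGaloisRestrict K Km y))) he'_lc he'_coc hfin' hinf'
  clear hfin' hinf' he'_lc he'_coc hmP hgood hP hloc_cocycle
  -- Kummer correction over `K_m`: make the cochain `μ_p`-valued (`exists_nsmul_split_of_apply_eq_cob`)
  obtain ⟨i, hi_def⟩ : ∃ i : absoluteGaloisGroup Km →ₜ* absoluteGaloisGroup K, i = absGaloisRestrict K Km :=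
    ⟨_, rfl⟩
  obtain ⟨ιm, hιm_def⟩ : ∃ ιm : AlgebraicClosure K →ₐ[K] AlgebraicClosure Km, ιm = absClosureEmbedding K Km :=
    ⟨_, rfl⟩
  rw [← hi_def, ← hιm_def] at hb'
  have hζm : IsPrimitiveRoot (ιm ζb) p := hζb.map_of_injective ιm.injective
  have hζm_fix : ∀ σ : absoluteGaloisGroup Km, σ • ιm ζb = ιm ζb := fun σ => by
    rw [hιm_def, hζb_def, AlgHom.commutes, IsScalarTower.algebraMap_apply K Km (AlgebraicClosure Km),
      absoluteGaloisGroup.smul_def, AlgEquiv.commutes]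
  have hb'val : ∀ σ τ', ιm (mexp (z (i σ) (i τ'))) =
      (b' σ : AlgebraicClosure Km) * σ • (b' τ' : AlgebraicClosure Km) / (b' (σ * τ') : AlgebraicClosure Km) :=
    fun σ τ' => by
      have h := congrArg (fun u : (AlgebraicClosure Km)ˣ => (u : AlgebraicClosure Km)) (hb' σ τ')
      simp only [Units.val_div_eq_div_val, Units.val_mul, Units.coe_smul, Units.coe_map, MonoidHom.coe_coe,
        he_val] at h
      exact h
  obtain ⟨B, hB_lc, hBp, hzB⟩ := exists_nsmul_split_of_apply_eq_cob Km (p := p) hζm hζm_fix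
    (fun t => ιm (mexp t))
    (fun x y hx hy => by simp only [hm_add x y hx hy, map_mul])
    (fun x y hx hy hxy => hm_inj x y hx hy (ιm.injective hxy))
    (fun x => by simp only [← map_pow, hm_pow, map_one])
    (fun t => by obtain ⟨k, hk⟩ := hm_range t; exact ⟨k, by simp only [hk, map_pow]⟩)
    (fun k => by obtain ⟨x, hx, hxk⟩ := hm_surj k; exact ⟨x, hx, by simp only [hxk, map_pow]⟩)
    (fun σ τ' => z (i σ) (i τ')) (fun σ τ' => hz_p _ _) b' hb'_lc hb'val
  -- transport `B` from `Γ_{K_m}` to `V_m = res(Γ_{K_m})`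
  have hrinj : Function.Injective i := hi_def ▸ absGaloisRestrict_injective K Km
  have hrange' : ((i : absoluteGaloisGroup Km →ₜ* absoluteGaloisGroup K) :
      absoluteGaloisGroup Km →* absoluteGaloisGroup K).range = V m := by rw [hi_def]; exact hrange
  let ψ₀ : absoluteGaloisGroup Km ≃ (V m) :=
    (Equiv.ofInjective i hrinj).trans (Equiv.setCongr (congrArg (fun H : Subgroup (absoluteGaloisGroup K) =>
      (H : Set (absoluteGaloisGroup K))) hrange'))
  have hψ₀val : ∀ x, ((ψ₀ x : V m) : absoluteGaloisGroup K) = i x := fun x => rfl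
  have hψ₀ : Continuous ψ₀ := Continuous.subtype_mk i.continuous _
  haveI : CompactSpace (V m) := isCompact_iff_compactSpace.mp (Subgroup.isClosed_of_isOpen _ (hVo m)).isCompact
  let ψ : absoluteGaloisGroup Km ≃ₜ (V m) := hψ₀.homeoOfEquivCompactToT2
  have hψ : ∀ x, ((ψ x : V m) : absoluteGaloisGroup K) = i x := fun x => rfl
  have hψsymm : ∀ s : V m, i (ψ.symm s) = s := fun s => by rw [← hψ, ψ.apply_symm_apply]
  have hψmul : ∀ s t : V m, ψ.symm (s * t) = ψ.symm s * ψ.symm t := fun s t => by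
    apply hrinj
    rw [map_mul i (ψ.symm s) (ψ.symm t), hψsymm, hψsymm, hψsymm]
    rfl
  refine ⟨m, fun s => B (ψ.symm s), hB_lc.comp_continuous ψ.symm.continuous, fun s => hBp _, fun s t => ?_⟩
  have key := hzB (ψ.symm s) (ψ.symm t)
  rw [hψsymm, hψsymm, ← hψmul] at key
  exact key

end Main

end Literature.NumberTheory.GaloisRepresentations

end
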